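import Literature.NumberTheory.Transcendental.SemialgebraicMapsProofs
import Mathlib.Analysis.Complex.Basic
import Mathlib.LinearAlgebra.Matrix.Determinant.Basic
import Mathlib.LinearAlgebra.Matrix.ToLin
import Mathlib.Topology.Algebra.Module.Determinant
import HarnessLib

/-!
# Algebraic pieces of the elliptic area identity: the addition-law map is semialgebraic; the reflection

Helper file for the support item `EllipticAreaIdentity` of route `MultivaluedCoV`
(`Summits/KontsevichZagierPeriods/KontsevichZagierPeriods/Theses/MultivaluedCoV.lean`).

* `isSemialgebraicMapOn_additionMap`: for `g₂, g₃ ∈ ℚ`, `f = 4x³ − g₂x − g₃`, the route's map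
  `Φ(s,t) = (−s − t + (f(s)+f(t))/(4(s−t)²), √(−f(s)f(t))/(2(s−t)²))` (the addition law of
  `y² = f(x)` in coordinates, crux `EllipticAreaCoV`) is `ℚ`-semialgebraic on any
  `ℚ`-semialgebraic set where `s ≠ t` (a rational function, and a square root of a polynomial
  times a rational function: tree `isSemialgebraicFunOn_aeval_div_aeval`,
  `IsSemialgebraicFunOn.sqrt_holds`, `IsSemialgebraicFunOn.mul_holds`);
* the reflection `(u,v) ↦ (u,−v)` of `ℝ²` as a continuous linear map (`reflect_apply`), its
  determinant `−1` (`det_reflect`), and the invariance `|f(u − iv)| = |f(u + iv)|` of the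
  integrand `1/|f(w)|` for real (rational) `g₂, g₃` (`norm_cubic_reflect`);
* `reIm_apply`: the real-linear map `(re, im) : ℂ → ℝ²` applied.

## References
* M. Kontsevich, D. Zagier, *Periods* (2001), §1.2, rule (2).
* J. Bochnak, M. Coste, M.-F. Roy, *Real Algebraic Geometry* (1998), §2.2.
-/

noncomputable section

open scoped ComplexConjugate
open Complex Set MvPolynomial ContinuousLinearMap
open Literature.NumberTheory.Transcendental

namespace Summit.KontsevichZagierPeriods.MultivaluedCoV.EllipticArea


/-- `(re, im) : ℂ → ℝ²` applied. -/
theorem reIm_apply (w : ℂ) :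
    (ContinuousLinearMap.pi ![reCLM, imCLM] : ℂ →L[ℝ] (Fin 2 → ℝ)) w = ![w.re, w.im] := by
  ext i
  fin_cases i <;> simp

/-- **Semialgebraicity of the addition-law map.** On any `ℚ`-semialgebraic `R ⊆ ℝ²` on which
`s ≠ t`, the map `(s,t) ↦ (−s − t + (f(s)+f(t))/(4(s−t)²), √(−f(s)f(t))/(2(s−t)²))`,
`f = 4x³ − g₂x − g₃` with `g₂, g₃ ∈ ℚ`, is `ℚ`-semialgebraic (rational function; square root of
a polynomial times a rational function). -/
theorem isSemialgebraicMapOn_additionMap (g₂ g₃ : ℚ) {R : Set (Fin 2 → ℝ)}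
    (hR : Literature.ModelTheory.ExponentialFields.IsSemialgebraic ℚ R) (hne : ∀ z ∈ R, z 0 ≠ z 1) :
    IsSemialgebraicMapOn ℚ R (fun z : Fin 2 → ℝ =>
      ![-z 0 - z 1 + ((4 * z 0 ^ 3 - (g₂ : ℝ) * z 0 - g₃) + (4 * z 1 ^ 3 - (g₂ : ℝ) * z 1 - g₃)) /
          (4 * (z 0 - z 1) ^ 2),
        Real.sqrt (-((4 * z 0 ^ 3 - (g₂ : ℝ) * z 0 - g₃) * (4 * z 1 ^ 3 - (g₂ : ℝ) * z 1 - g₃))) /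
          (2 * (z 0 - z 1) ^ 2)]) := by
  -- the polynomials
  set F : MvPolynomial (Fin 2) ℚ → MvPolynomial (Fin 2) ℚ := fun Y => 4 * Y ^ 3 - C g₂ * Y - C g₃
    with hF
  have hFe : ∀ (z : Fin 2 → ℝ) (i : Fin 2), aeval z (F (X i)) = 4 * z i ^ 3 - (g₂ : ℝ) * z i - g₃ := by
    intro z i
    simp [hF, map_sub, map_mul, eq_ratCast]
  have hq : ∀ z ∈ R, aeval z (4 * (X 0 - X 1) ^ 2 : MvPolynomial (Fin 2) ℚ) ≠ 0 := by
    intro z hz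
    have : aeval z (4 * (X 0 - X 1) ^ 2 : MvPolynomial (Fin 2) ℚ) = 4 * (z 0 - z 1) ^ 2 := by
      simp [map_mul, map_sub]
    rw [this]
    exact mul_ne_zero (by norm_num) (pow_ne_zero 2 (sub_ne_zero.mpr (hne z hz)))
  have hq' : ∀ z ∈ R, aeval z (2 * (X 0 - X 1) ^ 2 : MvPolynomial (Fin 2) ℚ) ≠ 0 := by
    intro z hz
    have : aeval z (2 * (X 0 - X 1) ^ 2 : MvPolynomial (Fin 2) ℚ) = 2 * (z 0 - z 1) ^ 2 := by
      simp [map_mul, map_sub]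
    rw [this]
    exact mul_ne_zero (by norm_num) (pow_ne_zero 2 (sub_ne_zero.mpr (hne z hz)))
  refine IsSemialgebraicMapOn.of_forall hR (Fin.forall_fin_two.mpr ⟨?_, ?_⟩)
  · -- first coordinate: a rational function
    refine (isSemialgebraicFunOn_aeval_div_aeval hR
      ((-X 0 - X 1) * (4 * (X 0 - X 1) ^ 2) + (F (X 0) + F (X 1))) (4 * (X 0 - X 1) ^ 2) hq).congr
      fun z hz => ?_
    have h4 : z 0 - z 1 ≠ 0 := sub_ne_zero.mpr (hne z hz)
    simp only [Matrix.cons_val_zero, map_add, map_mul, hFe]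
    simp [map_sub]
    field_simp
  · -- second coordinate: `√(poly) · (1 / poly)`
    have h1 : IsSemialgebraicFunOn ℚ R (fun z => Real.sqrt (aeval z (-(F (X 0) * F (X 1))))) :=
      IsSemialgebraicFunOn.sqrt_holds (isSemialgebraicFunOn_aeval hR _)
    have h2 := isSemialgebraicFunOn_aeval_div_aeval hR (1 : MvPolynomial (Fin 2) ℚ)
      (2 * (X 0 - X 1) ^ 2) hq'
    refine (IsSemialgebraicFunOn.mul_holds h1 h2).congr fun z hz => ?_
    simp only [Matrix.cons_val_one, Matrix.cons_val_zero, Pi.mul_apply, map_neg, map_mul, hFe,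
      map_one]
    simp [map_sub, div_eq_mul_inv]



/-! ### The reflection `(u, v) ↦ (u, −v)` -/

/-- The reflection `(u,v) ↦ (u,−v)` of `ℝ²`, applied. -/
theorem reflect_apply (w : Fin 2 → ℝ) :
    (ContinuousLinearMap.pi ![proj 0, -proj 1] : (Fin 2 → ℝ) →L[ℝ] (Fin 2 → ℝ)) w = ![w 0, -w 1] := by
  ext i
  fin_cases i <;> simp

/-- The reflection has determinant `−1`. -/
theorem det_reflect :
    (ContinuousLinearMap.pi ![proj 0, -proj 1] : (Fin 2 → ℝ) →L[ℝ] (Fin 2 → ℝ)).det = -1 := by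
  rw [ContinuousLinearMap.det, ← LinearMap.det_toMatrix', Matrix.det_fin_two]
  simp [LinearMap.toMatrix'_apply]

/-- The integrand `1/|f(u+iv)|` is invariant under `v ↦ −v` (real coefficients). -/
theorem norm_cubic_reflect (g₂ g₃ : ℚ) (u v : ℝ) :
    ‖4 * ((u : ℂ) + ((-v : ℝ) : ℂ) * I) ^ 3 - (g₂ : ℂ) * ((u : ℂ) + ((-v : ℝ) : ℂ) * I) - (g₃ : ℂ)‖ =
      ‖4 * ((u : ℂ) + (v : ℂ) * I) ^ 3 - (g₂ : ℂ) * ((u : ℂ) + (v : ℂ) * I) - (g₃ : ℂ)‖ := by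
  have h1 : (u : ℂ) + ((-v : ℝ) : ℂ) * I = conj ((u : ℂ) + (v : ℂ) * I) := by
    simp [map_add, map_mul, Complex.conj_ofReal, Complex.conj_I]
  have h2 : 4 * conj ((u : ℂ) + (v : ℂ) * I) ^ 3 - (g₂ : ℂ) * conj ((u : ℂ) + (v : ℂ) * I) - (g₃ : ℂ) =
      conj (4 * ((u : ℂ) + (v : ℂ) * I) ^ 3 - (g₂ : ℂ) * ((u : ℂ) + (v : ℂ) * I) - (g₃ : ℂ)) := by
    simp [map_sub, map_mul, map_pow, map_ofNat]
  rw [h1, h2, Complex.norm_conj]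

end Summit.KontsevichZagierPeriods.MultivaluedCoV.EllipticArea

end
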